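import Mathlib
import HarnessLib

/-!
# Route `GenusKolyvaginAtTwo`, crux L_T `PowDvdShaCardAtTwoRT` (stmt-BirchSwinnertonDyer-23242), LINE 18 stub L, bottom rung:
# THE DOUBLING PACKAGE AT A DEEP OWN PRIME — `M := (2•)⁻¹ H¹_tr = H¹_f[2] ⊕ H¹_tr`, its order, and `2⟨z, w⟩ = 0` on it (pure algebra)

Seat `bsd-line-gk2-p3` g21 (PROVER seat 3/3, cell `bsd-f1-sign2`), `--supports 23242 --as helper`.  THEOREMS ONLY (Mathlib-only,
no definition, no `sorry`, standard axioms).  BSD is NOT proved by any of this; neither is the crux nor stub L.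

WHY (LEAD memo `Cruxes/PowDvdShaCardAtTwoRT/Lines/plus-descent-lead-g16.md` §8).  At a deep own prime `ℓ ∈ t` of the `k`-minimal
witness, `H := H¹(ℚ_ℓ, E^ε[4]) = H¹_f ⊕ H¹_tr` with `H¹_tr` isotropic for the local Weil–Tate pairing (I7, `…RTTransverseIsotropic`; the
isotropy of `H¹_f = 𝓛_ℓ` turns out NOT to be needed) and `H¹_f ≅ ℤ/4` cyclic (McCallum Lemma 5.3 over `ℚ_ℓ`).  The engine's own-prime
localisation `Z_ℓ` and the auxiliary `y_ℓ` both lie in **`M := {z : 2•z ∈ H¹_tr} = H¹_f[2] ⊕ H¹_tr`**, and then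
**`⟨X_ℓ, y_ℓ⟩ = 2⟨Z_ℓ, y_ℓ⟩ = 0` BY BILINEARITY ALONE** (`z = f₁ + t₁`, `w = f₂ + t₂`, `2f₁ = 2f₂ = 0`:
`2⟨z,w⟩ = ⟨2f₁,w⟩ + ⟨t₁,2f₂⟩ + 2⟨t₁,t₂⟩ = 0`), and `#M = #H¹_f[2]·#H¹_tr = 2·4 = 8` (index `2` in `H`), the
number the general order-4 auxiliary consumes (`…RTOrderFourAuxiliaryGeneral`, this seat).  This file is the ABSTRACT package, for
an additive commutative group `H`, subgroups `F, Tr ≤ H` with `F ⊓ Tr = ⊥`, `F ⊔ Tr = ⊤`, and a biadditive `b : H →+ H →+ R`: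
* `exists_add_eq_of_two_nsmul_mem` / `two_nsmul_add_mem` — `2•z ∈ Tr ↔ z = f + t` with `f ∈ F`, `2•f = 0`, `t ∈ Tr`;
* **`two_nsmul_pairing_eq_zero_of_two_nsmul_mem`** — `b` isotropic on `Tr` (isotropy of `F` is NOT needed), `2•z, 2•w ∈ Tr` ⟹
  `2 • b z w = 0` (also the one-sided forms `pairing_two_nsmul_eq_zero_of_two_nsmul_mem`: `b (2•z) w = 0`, and `b z (2•w) = 0`);
* `natCard_comap_two_nsmul_eq` — `#(2•)⁻¹Tr = #(F ⊓ ker 2•) · #Tr`; `natCard_eq_natCard_mul_natCard_of_disjoint_codisjoint` — `#H = #F·#Tr`;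
* **`natCard_comap_two_nsmul_eq_eight`** — `#F = 4`, `F` not killed by `2`, `#Tr = 4` ⟹ `#(2•)⁻¹Tr = 8`; and
  `index_comap_two_nsmul_eq_two` — its index in `H` is `2` (`#H = 16`).
HONEST FRAMING: pure finite-abelian-group bookkeeping; the arithmetic inputs (the splitting `H¹ = H¹_f ⊕ H¹_tr` over `ℚ_ℓ` at level
`4`, the two isotropies, `Z_ℓ ∈ M`) are NOT here.  Closes nothing.  BSD is NOT proved by any of this.

References: [McCallumLMS1991] §5 Lemma 5.3 and proof of Prop. 5.2 (p. 309); [MilneADT2006] Ch. I Cor. 2.3.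
-/

set_option autoImplicit false
-- the Theorems namespace of this sub repeats the summit name by design (D-0017 nested layout)
set_option linter.dupNamespace false

namespace Summit.BirchSwinnertonDyer.BirchSwinnertonDyer.Theorems.GenusExact.DoublingIsotropy

variable {H : Type*} [AddCommGroup H] (F Tr : AddSubgroup H)

/-! ## §1 The subgroup `(2•)⁻¹ Tr = F[2] ⊕ Tr` -/

/-- Membership in `(2•)⁻¹ Tr` through the additive monoid hom `2•`. [folklore] -/
theorem mem_comap_two_nsmul_iff (z : H) : z ∈ Tr.comap (nsmulAddMonoidHom 2) ↔ 2 • z ∈ Tr := by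
  rw [AddSubgroup.mem_comap, nsmulAddMonoidHom_apply]

/-- **`2•z ∈ Tr ⟹ z = f + t` with `f ∈ F`, `2•f = 0`, `t ∈ Tr`** when `H = F ⊕ Tr` (`F ⊓ Tr = ⊥`, `F ⊔ Tr = ⊤`): write `z = f + t`;
then `2•f = 2•z − 2•t ∈ F ⊓ Tr = 0`. [folklore] -/
theorem exists_add_eq_of_two_nsmul_mem (hdis : Disjoint F Tr) (hcod : Codisjoint F Tr) {z : H} (hz : 2 • z ∈ Tr) :
    ∃ f ∈ F, ∃ t ∈ Tr, 2 • f = 0 ∧ f + t = z := by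
  have hz' : z ∈ F ⊔ Tr := by rw [hcod.eq_top]; exact AddSubgroup.mem_top z
  obtain ⟨f, hf, t, ht, rfl⟩ := AddSubgroup.mem_sup.mp hz'
  refine ⟨f, hf, t, ht, ?_, rfl⟩
  have h2f : 2 • f ∈ Tr := by
    have : 2 • f = 2 • (f + t) - 2 • t := by rw [smul_add]; abel
    rw [this]
    exact Tr.sub_mem hz (Tr.nsmul_mem ht 2)
  have hmem : 2 • f ∈ F ⊓ Tr := AddSubgroup.mem_inf.mpr ⟨F.nsmul_mem hf 2, h2f⟩
  rw [hdis.eq_bot] at hmem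
  exact (AddSubgroup.mem_bot).mp hmem

/-- Conversely `f ∈ F` with `2•f = 0` and `t ∈ Tr` give `2•(f + t) = 2•t ∈ Tr`. [folklore] -/
theorem two_nsmul_add_mem {f t : H} (hf2 : 2 • f = 0) (ht : t ∈ Tr) : 2 • (f + t) ∈ Tr := by
  rw [smul_add, hf2, zero_add]
  exact Tr.nsmul_mem ht 2

/-! ## §2 Doubling kills the pairing on `(2•)⁻¹ Tr` -/

section Pairing

variable {R : Type*} [AddCommGroup R] (b : H →+ H →+ R)

/-- **`b (2•z) w = 0` for `z, w ∈ (2•)⁻¹ Tr`** when `b` is isotropic on `Tr` and `H = F ⊕ Tr` (NO isotropy of `F` is needed):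
with `z = f₁ + t₁`, `w = f₂ + t₂`, `2f₁ = 2f₂ = 0`, one has `b (2z) w = b (2t₁) (f₂ + t₂) = b t₁ (2f₂) + 2 b t₁ t₂ = 0`.  This is the LEAD's «`⟨X_ℓ, y_ℓ⟩ =
2⟨Z_ℓ, y_ℓ⟩ = 0` by bilinearity alone» at a deep own prime (memo §8), with `X = 2Z`. [cite: McCallumLMS1991, §5 proof of Prop. 5.2] -/
theorem pairing_two_nsmul_eq_zero_of_two_nsmul_mem (hTr : ∀ t ∈ Tr, ∀ t' ∈ Tr, b t t' = 0)
    (hdis : Disjoint F Tr) (hcod : Codisjoint F Tr) {z w : H} (hz : 2 • z ∈ Tr) (hw : 2 • w ∈ Tr) :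
    b (2 • z) w = 0 := by
  obtain ⟨f₁, hf₁, t₁, ht₁, h2f₁, rfl⟩ := exists_add_eq_of_two_nsmul_mem F Tr hdis hcod hz
  obtain ⟨f₂, hf₂, t₂, ht₂, h2f₂, rfl⟩ := exists_add_eq_of_two_nsmul_mem F Tr hdis hcod hw
  have h1 : 2 • (f₁ + t₁) = 2 • t₁ := by rw [smul_add, h2f₁, zero_add]
  rw [h1, map_nsmul, AddMonoidHom.nsmul_apply, map_add, smul_add, hTr t₁ ht₁ t₂ ht₂, smul_zero, add_zero,
    ← map_nsmul, h2f₂, map_zero]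

/-- **`2 • b z w = 0` for `z, w ∈ (2•)⁻¹ Tr`** (the doubled pairing vanishes) under the same hypotheses. [cite: McCallumLMS1991, §5 proof of Prop. 5.2] -/
theorem two_nsmul_pairing_eq_zero_of_two_nsmul_mem
    (hTr : ∀ t ∈ Tr, ∀ t' ∈ Tr, b t t' = 0) (hdis : Disjoint F Tr) (hcod : Codisjoint F Tr) {z w : H} (hz : 2 • z ∈ Tr)
    (hw : 2 • w ∈ Tr) : 2 • b z w = 0 := by
  rw [← AddMonoidHom.nsmul_apply, ← map_nsmul]
  exact pairing_two_nsmul_eq_zero_of_two_nsmul_mem F Tr b hTr hdis hcod hz hw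

/-- The symmetric one-sided form `b z (2•w) = 0`. [folklore] -/
theorem pairing_right_two_nsmul_eq_zero_of_two_nsmul_mem
    (hTr : ∀ t ∈ Tr, ∀ t' ∈ Tr, b t t' = 0) (hdis : Disjoint F Tr) (hcod : Codisjoint F Tr) {z w : H} (hz : 2 • z ∈ Tr)
    (hw : 2 • w ∈ Tr) : b z (2 • w) = 0 := by
  rw [map_nsmul]
  exact two_nsmul_pairing_eq_zero_of_two_nsmul_mem F Tr b hTr hdis hcod hz hw

end Pairing

/-! ## §3 Orders -/

/-- **`#H = #F · #Tr`** for `H = F ⊕ Tr` (`F ⊓ Tr = ⊥`, `F ⊔ Tr = ⊤`): `(f, t) ↦ f + t` is a bijection. [folklore] -/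
theorem natCard_eq_natCard_mul_natCard_of_disjoint_codisjoint (hdis : Disjoint F Tr) (hcod : Codisjoint F Tr) :
    Nat.card H = Nat.card F * Nat.card Tr := by
  rw [← Nat.card_prod]
  refine (Nat.card_congr (Equiv.ofBijective (fun p : F × Tr ↦ (p.1 : H) + p.2) ⟨?_, ?_⟩)).symm
  · rintro ⟨⟨f, hf⟩, ⟨t, ht⟩⟩ ⟨⟨f', hf'⟩, ⟨t', ht'⟩⟩ h
    change f + t = f' + t' at h
    have hft : f - f' = t' - t := by rw [sub_eq_sub_iff_add_eq_add, h, add_comm]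
    have hmem : f - f' ∈ F ⊓ Tr :=
      AddSubgroup.mem_inf.mpr ⟨F.sub_mem hf hf', by rw [hft]; exact Tr.sub_mem ht' ht⟩
    rw [hdis.eq_bot, AddSubgroup.mem_bot, sub_eq_zero] at hmem
    subst hmem
    have htt : t = t' := by
      have := congrArg (fun x ↦ -f + x) h
      simpa using this
    subst htt
    rfl
  · intro z
    have hz' : z ∈ F ⊔ Tr := by rw [hcod.eq_top]; exact AddSubgroup.mem_top z
    obtain ⟨f, hf, t, ht, rfl⟩ := AddSubgroup.mem_sup.mp hz'
    exact ⟨⟨⟨f, hf⟩, ⟨t, ht⟩⟩, rfl⟩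

/-- **`#(2•)⁻¹Tr = #(F ⊓ ker 2•) · #Tr`**: `(f, t) ↦ f + t` is a bijection `F[2] × Tr → (2•)⁻¹ Tr` (§1). [folklore] -/
theorem natCard_comap_two_nsmul_eq (hdis : Disjoint F Tr) (hcod : Codisjoint F Tr) :
    Nat.card (Tr.comap (nsmulAddMonoidHom (2 : ℕ))) =
      Nat.card (F ⊓ (nsmulAddMonoidHom (2 : ℕ) : H →+ H).ker : AddSubgroup H) * Nat.card Tr := by
  rw [← Nat.card_prod]
  symm
  refine Nat.card_congr (Equiv.ofBijective
    (fun p : (F ⊓ (nsmulAddMonoidHom (2 : ℕ) : H →+ H).ker : AddSubgroup H) × Tr ↦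
      (⟨(p.1 : H) + p.2, ?_⟩ : Tr.comap (nsmulAddMonoidHom (2 : ℕ)))) ⟨?_, ?_⟩)
  · obtain ⟨⟨f, hf⟩, ⟨t, ht⟩⟩ := p
    have hf2 : 2 • f = 0 := by
      have := (AddSubgroup.mem_inf.mp hf).2
      rwa [AddMonoidHom.mem_ker, nsmulAddMonoidHom_apply] at this
    exact (mem_comap_two_nsmul_iff Tr _).mpr (two_nsmul_add_mem Tr hf2 ht)
  · rintro ⟨⟨f, hf⟩, ⟨t, ht⟩⟩ ⟨⟨f', hf'⟩, ⟨t', ht'⟩⟩ h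
    replace h : f + t = f' + t' := congrArg Subtype.val h
    have hft : f - f' = t' - t := by rw [sub_eq_sub_iff_add_eq_add, h, add_comm]
    have hmem : f - f' ∈ F ⊓ Tr :=
      AddSubgroup.mem_inf.mpr ⟨F.sub_mem (AddSubgroup.mem_inf.mp hf).1 (AddSubgroup.mem_inf.mp hf').1,
        by rw [hft]; exact Tr.sub_mem ht' ht⟩
    rw [hdis.eq_bot, AddSubgroup.mem_bot, sub_eq_zero] at hmem
    subst hmem
    have htt : t = t' := by
      have := congrArg (fun x ↦ -f + x) h
      simpa using this
    subst htt
    rfl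
  · rintro ⟨z, hz⟩
    obtain ⟨f, hf, t, ht, h2f, rfl⟩ :=
      exists_add_eq_of_two_nsmul_mem F Tr hdis hcod ((mem_comap_two_nsmul_iff Tr _).mp hz)
    refine ⟨⟨⟨f, AddSubgroup.mem_inf.mpr ⟨hf, ?_⟩⟩, ⟨t, ht⟩⟩, rfl⟩
    rwa [AddMonoidHom.mem_ker, nsmulAddMonoidHom_apply]

/-- **`#F[2] = 2` for `F` of order `4` not killed by `2`**: `F ⊓ ker(2•)` is a proper subgroup of `F` (so of order `1` or `2`,
dividing `4`) containing an element of order `2` (Cauchy). [folklore] -/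
theorem natCard_inf_ker_two_nsmul_eq_two (hF4 : Nat.card F = 4) (hF2 : ∃ f ∈ F, 2 • f ≠ 0) :
    Nat.card (F ⊓ (nsmulAddMonoidHom (2 : ℕ) : H →+ H).ker : AddSubgroup H) = 2 := by
  classical
  haveI : Finite F := Nat.finite_of_card_ne_zero (by rw [hF4]; norm_num)
  set K : AddSubgroup H := F ⊓ (nsmulAddMonoidHom (2 : ℕ) : H →+ H).ker with hK
  have hKF : K ≤ F := inf_le_left
  -- `#K ∣ 4`
  have hdvd : Nat.card K ∣ 4 := by rw [← hF4]; exact AddSubgroup.card_dvd_of_le hKF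
  -- `#K ≠ 4`
  have hne4 : Nat.card K ≠ 4 := by
    intro h4
    obtain ⟨f, hf, hf2⟩ := hF2
    have hKF' : K = F := AddSubgroup.eq_of_le_of_card_ge hKF (by rw [h4, hF4])
    have : f ∈ K := by rw [hKF']; exact hf
    exact hf2 (by simpa [hK, AddMonoidHom.mem_ker] using (AddSubgroup.mem_inf.mp this).2)
  -- an element of order `2` in `F`
  haveI : Fact (Nat.Prime 2) := ⟨Nat.prime_two⟩
  obtain ⟨g, hg⟩ := exists_prime_addOrderOf_dvd_card' (G := F) 2 (by rw [hF4]; norm_num)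
  have hgK : (g : H) ∈ K := by
    refine AddSubgroup.mem_inf.mpr ⟨g.2, ?_⟩
    rw [AddMonoidHom.mem_ker, nsmulAddMonoidHom_apply]
    have := addOrderOf_nsmul_eq_zero g
    rw [hg] at this
    exact_mod_cast congrArg Subtype.val this
  have hg0 : (g : H) ≠ 0 := by
    intro h0
    have : g = 0 := Subtype.ext h0
    rw [this, addOrderOf_zero] at hg
    norm_num at hg
  -- `#K ≥ 2`
  haveI : Finite K := Finite.of_injective _ (AddSubgroup.inclusion_injective hKF)
  haveI : Fintype K := Fintype.ofFinite K
  have h2le : 2 ≤ Nat.card K := by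
    rw [← Finset.card_pair (a := (⟨(g : H), hgK⟩ : K)) (b := 0) (by simpa using hg0), Nat.card_eq_fintype_card]
    exact Finset.card_le_univ _
  -- divisors of 4 that are ≥ 2 and ≠ 4
  have : Nat.card K ∈ Nat.divisors 4 := Nat.mem_divisors.mpr ⟨hdvd, by norm_num⟩
  rw [show Nat.divisors 4 = {1, 2, 4} from by decide] at this
  simp only [Finset.mem_insert, Finset.mem_singleton] at this
  omega

/-- **`#(2•)⁻¹ Tr = 8`** when `H = F ⊕ Tr`, `#F = 4` with `F` not killed by `2` (e.g. `F ≅ ℤ/4`), and `#Tr = 4` — the order of the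
deep-own-prime condition `H¹_f[2] ⊕ H¹_tr ≤ H¹(ℚ_ℓ, E[4])` of LINE 18's bottom-rung engine (LEAD memo §8: `#H¹_f = #H¹_tr = 4`,
`H¹_f` cyclic). [cite: McCallumLMS1991, §5 Lemma 5.3 and proof of Prop. 5.2] -/
theorem natCard_comap_two_nsmul_eq_eight (hdis : Disjoint F Tr) (hcod : Codisjoint F Tr) (hF4 : Nat.card F = 4)
    (hF2 : ∃ f ∈ F, 2 • f ≠ 0) (hTr4 : Nat.card Tr = 4) :
    Nat.card (Tr.comap (nsmulAddMonoidHom (2 : ℕ))) = 8 := by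
  rw [natCard_comap_two_nsmul_eq F Tr hdis hcod, natCard_inf_ker_two_nsmul_eq_two F hF4 hF2, hTr4]

/-- **`(2•)⁻¹ Tr` has index `2` in `H`** under the same hypotheses (`#H = 4·4 = 16`, `#(2•)⁻¹Tr = 8`). [folklore] -/
theorem index_comap_two_nsmul_eq_two (hdis : Disjoint F Tr) (hcod : Codisjoint F Tr) (hF4 : Nat.card F = 4)
    (hF2 : ∃ f ∈ F, 2 • f ≠ 0) (hTr4 : Nat.card Tr = 4) :
    (Tr.comap (nsmulAddMonoidHom (2 : ℕ))).index = 2 := by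
  have hH : Nat.card H = 16 := by
    rw [natCard_eq_natCard_mul_natCard_of_disjoint_codisjoint F Tr hdis hcod, hF4, hTr4]
  haveI : Finite H := Nat.finite_of_card_ne_zero (by rw [hH]; norm_num)
  have h := (Tr.comap (nsmulAddMonoidHom (2 : ℕ))).card_mul_index
  rw [natCard_comap_two_nsmul_eq_eight F Tr hdis hcod hF4 hF2 hTr4, hH] at h
  omega

end Summit.BirchSwinnertonDyer.BirchSwinnertonDyer.Theorems.GenusExact.DoublingIsotropy
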